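import Summits.QuantumFields.BalabanUV.Beta.D1BFx.ChartDefectLiteralChartPin
import Summits.QuantumFields.BalabanUV.Beta.D1BFx.ChartDefectTwoPinsRoad
import Summits.QuantumFields.BalabanUV.Beta.D1BFx.DressedMixVertexSiteNull
import Summits.QuantumFields.BalabanUV.Beta.KernelWardSwap

/-!
# `BalabanUV.Beta.D1BFx.ChartDefectTwoPinsRest` — road «BF-x», binder row D1, PART 24 HEAD (H3-Δ) §2 at the RECORD: **THREE ROWS OF THE WORD LIST
# `ChartDefectTwoPins.chartDefect_record_eq_words` REDUCED BY IDENTITIES OF THE TREE** (an2 R-D1-g45-5: identities FIRST) —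
# (i) `tadpole_rest_record_eq`: under the road's tadpole the (D-R) rest `W2SymOfK K₀ n S♭ M⁰ S₂⁰ M₂⁰ − vertex2OfK K₀ n S₂⁰` IS the STRAIGHT MIXED PAIR
# `mixOfK K₀ n M₂⁰ μ y ν y′ + mixOfK K₀ n M₂⁰ ν y′ μ y`: the swap pair vanishes because the record's pair table is swap-SYMMETRIC (`wilsonW₂_wsym22_swap`, `symVh₂SAn1_swap`;
# `KernelWardSwap.vertex2OfK_swap_eq_transpose`), the response pair is tadpole-NULL by row parity (`SpineRecursiveParity.tadpole_dM_eq_zero_of_rows` with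
# `BubbleParity.trK_coDressKBmAt_KInvStep`, `trK_wilsonA`, `trK_symVhSAt`, `trK_M1Of_symHessFFAt`) — Engine C's «the dM K2OfK word vanishes identically» in the kernel;
# (ii) `tadpole_WMs_record_eq`: leaf-03 g31's TT21 `SymCorrectorMixedSiteNull.tadpole_WMs_eq` AT THE RECORD — the face mixed word under the tadpole is half a commutator word;
# (iii) `tadpole_WMcol_record_eq`: leaf-03 g32's TT23 `DressedMixVertexSiteNull.tadpole_WMcol_eq_Wmix` AT THE RECORD with `CombMixedSiteLetter.divV_M2Of_record_eq` — the column
# mixed word under the tadpole is the `Wmix(Λ′_c; V_H)` bracket of leaf-01 g32's `ColumnGaugePairContact.vertexFamily₂_Wmix_of_weight` (`ξ := 1`).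

HONEST DEPENDENCY (cell records, verbatim): «continuum YM on T⁴ ⇐ BetaPertH ∧ nine spine estimates (0/9 proved); BetaPertH ⇐ (D1) ∧ (D4) ∧
CAP+tail; G-an2-4 gates asym, D1 and NE2/3/4.»  HONEST FRAMING (cell contract, verbatim): «discharging `BetaPertH` makes Bałaban's UV stability
UNCONDITIONAL — a real constructive-QFT result; it is NOT the continuum limit and NOT the Clay problem.»  THIS MODULE DISCHARGES NO binder of row D1 and
NO estimate of Bałaban's: three [our object] identities under the road's tadpole, composed BY NAME; prices NO row; no definition, no `def … : Prop`,
nothing cited, 0 sorry.  0∕4 row-D1 binders; (K) NOT closed; (J1) ONE OPEN ROW `hC₁ := Δ_n`; NOT D1, NEVER «G-an2-4 closed», NOT `BetaPertH`, NOT continuum, NOT Clay.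

ABSOLUTE RULE (cell charter, verbatim): «No internally-minted statement may enter as a cited fact. Every hypothesis is either kernel-proved in this
package or a verbatim quotation of a PUBLISHED theorem with page reference. The manuscript(s) under audit are NOT citable for their own disputed
steps — they are the thing under adjudication; programme-internal (2001/route/tribunal) claims are never citable.»

Unit `b2b-balaban-beta-d1-p2` (road owner, gen 25), 2026-08-23; no existing file touched.
-/

noncomputable section

namespace Summit.QuantumFields.BalabanUV.Beta.D1BFx.ChartDefectTwoPinsRest

open Finset
open scoped BigOperators
open Literature.MathematicalPhysics.QuantumFieldTheory
open Literature.MathematicalPhysics.QuantumFieldTheory.LatticeForm (quo)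
open Literature.MathematicalPhysics.QuantumFieldTheory.Balaban1983to89
open Literature.MathematicalPhysics.QuantumFieldTheory.Balaban1983to89.Beta
open B12Sec2to5 (l1 l1_nonneg)
open B4ContourShift (supNorm)
open WilsonVertex2Sym (wsym22)
open WilsonBiStencil (wilsonW₂ wilsonW₂_smul)
open StepJetData (wilsonA)
open AveragingHessianKernels (ell)
open KernelReflection (tadpole_smul)
open ExpKernelCalculus (MKer VertexFamily comp tadpole)
open OneStepResolventKernel (Fib LocStencil)
open OneStepKernelFamily (colH vertexOfK KInvStep)
open SecondOrderResponse (vertexOfM dM K2OfK mixOfK W2OfK W2SymOfK vertex2OfK LocStencilFM vertexFamily_vertexOfM)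
open BalabanCompositeJets (LocStencil₂)
open BalabanStepW2 (M2Of vertexFamily_mono')
open AffineAveraging (Site box toSite)
open AveragingContours (blk)
open AveragingContoursRooted (ctr ctrOff ctrOff_mem_box)
open Summit.QuantumFields.BalabanUV.Beta.TameKernelCalculus (Spr Loc trK decays_of_le tadpole_add)
open Summit.QuantumFields.BalabanUV.Beta.KernelWardRelative (tadpole_sub)
open Summit.QuantumFields.BalabanUV.Beta.BorderedHessian (diagK sgnK spr_KInvStep)
open Summit.QuantumFields.BalabanUV.Beta.ChartConjugation (conjV)
open Summit.QuantumFields.BalabanUV.Beta.AxialDressingRooted (coDressKBmAt)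
open Summit.QuantumFields.BalabanUV.Beta.AxialProjectorBlockMean (bmGaugeAt)
open Summit.QuantumFields.BalabanUV.Beta.AveragingWardRootedStencils (legSite)
open Summit.QuantumFields.BalabanUV.Beta.SymAveragingHessianCounts (symVhSAt symHessFFAt vertexFamily_symHessFFAt)
open Summit.QuantumFields.BalabanUV.Beta.SymSecondOrderTablesAn1 (symVh₂SAn1 symTablesAn1S2 symVh₂SAn1_swap)
open Summit.QuantumFields.BalabanUV.Beta.CompositeCorrectorLocality (blockSitesF)
open Summit.QuantumFields.BalabanUV.Beta.SymCorrectorFace (faceWt)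
open Summit.QuantumFields.BalabanUV.Beta.SymCorrectorMixedSiteNull (tadpole_WMs_eq)
open Summit.QuantumFields.BalabanUV.Beta.SymCorrectorResponseNull (loc_dM_K2OfK)
open Summit.QuantumFields.BalabanUV.Beta.SymCorrectorLiteralLoc (locStencilFM_literalM₂ loc_mixOfK_of_spr)
open Summit.QuantumFields.BalabanUV.Beta.SpineRooted (T2RecOf_zero_level)
open Summit.QuantumFields.BalabanUV.Beta.SpineRecursiveParity (tadpole_dM_eq_zero_of_rows trK_wilsonA parityOdd_smul)
open Summit.QuantumFields.BalabanUV.Beta.KernelWardRemainderParity (parityOdd_add)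
open Summit.QuantumFields.BalabanUV.Beta.SymTablesAn1FirstOrder (trK_symVhSAt trK_symHessFFAt trK_M1Of_symHessFFAt)
open Summit.QuantumFields.BalabanUV.Beta.BubbleParity (trK_coDressKBmAt_KInvStep)
open Summit.QuantumFields.BalabanUV.Beta.WilsonBiStencilWardSocket (wilsonW₂_wsym22_swap)
open Summit.QuantumFields.BalabanUV.Beta.KernelWardSwap (vertex2OfK_swap_eq_transpose)
open Summit.QuantumFields.BalabanUV.Beta.CombSecondOrderClassBase (locStencil₂_T2RecOf_symTablesAn1)
open Summit.QuantumFields.BalabanUV.Beta.D1BFx.ChartDefectResolvent (spr_G0bm_ctr)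
open Summit.QuantumFields.BalabanUV.Beta.D1BFx.RawStencilSupportRows (locStencil_pure_zero)
open Summit.QuantumFields.BalabanUV.Beta.D1BFx.PackedColumnEnvelope (abs_colH_KInvStep_zero_le)
open Summit.QuantumFields.BalabanUV.Beta.D1BFx.ChartDefectWords (loc_vertex2OfK_of_spr)
open Summit.QuantumFields.BalabanUV.Beta.D1BFx.CombMixedSiteLetter (divV_M2Of_record_eq)
open Summit.QuantumFields.BalabanUV.Beta.D1BFx.DressedMixVertexSiteNull (tadpole_WMcol_eq_Wmix)
open B5Hk163Strip (kappa163 kappa163_pos)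
open B5Hk163Decay (MG163)
open B4TorusKernel (periodConst)

variable {n : ℕ} [NeZero n] (N : ℕ)

/-- **(i) THE (D-R) REST UNDER THE ROAD's TADPOLE IS THE STRAIGHT MIXED PAIR** [our object]: with `K₀ := KInvStep n 0`, `G₀ := coDressKBmAt ρ_c n K₀` and the record's
level-0 tables `S♭`, `M⁰ = tabs.M 0`, `S₂⁰`, `M₂⁰ = M2Of 3 n tabs.mixFF 0` (`tabs = symTablesAn1S2 3 n cΛ`, lockB `cB = −n¹²∕4`),
`tadpole G₀ (W2SymOfK K₀ n S♭ M⁰ S₂⁰ M₂⁰ μ y ν y′ − vertex2OfK K₀ n S₂⁰ μ y ν y′) = tadpole G₀ (mixOfK K₀ n M₂⁰ μ y ν y′ + mixOfK K₀ n M₂⁰ ν y′ μ y)`: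
`W2SymOfK = ½•(W2OfK μyνy′ + W2OfK νy′μy)` (`rfl`); the swapped bi-vertex IS the direct one because `S₂⁰` is swap-symmetric (`wilsonW₂_smul`, `wilsonW₂_wsym22_swap`,
`symVh₂SAn1_swap`; `KernelWardSwap.vertex2OfK_swap_eq_transpose`, Fubini socket `|S₂⁰| ≤ C₂` from `locStencil₂_T2RecOf_symTablesAn1`); both response words
`dM (K2OfK K₀ n S♭ M⁰ ·) n S♭ M⁰ ·` are tadpole-null at `G₀` (`tadpole_dM_eq_zero_of_rows`: `trK G₀ = sgnK G₀`, rows of `S♭`, `M⁰` parity-odd). -/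
theorem tadpole_rest_record_eq (cΛ : ℝ) (μ : Fin 4) (y : Site 4) (ν : Fin 4) (y' : Site 4) :
    tadpole (coDressKBmAt (ctr 4 n) n (KInvStep (d := 3) n 0))
        (W2SymOfK (KInvStep (d := 3) n 0) n (fun κ u => ((n : ℝ) ^ 4) • wilsonA 3 κ u + (-((n : ℝ) ^ 8 / 2)) • symVhSAt (ctr 4 n) 3 n rfl κ u)
              ((symTablesAn1S2 3 n cΛ).M 0) (fun κ u κ' u' => ((n : ℝ) ^ 8) • wilsonW₂ 3 ((8 * (N : ℝ) ^ 2)⁻¹ • wsym22 N) κ u κ' u' + (-((n : ℝ) ^ 12 / 4)) • symVh₂SAn1 3 n κ u κ' u')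
              (M2Of 3 n (symTablesAn1S2 3 n cΛ).mixFF 0) μ y ν y'
          - vertex2OfK (KInvStep (d := 3) n 0) n
              (fun κ u κ' u' => ((n : ℝ) ^ 8) • wilsonW₂ 3 ((8 * (N : ℝ) ^ 2)⁻¹ • wsym22 N) κ u κ' u' + (-((n : ℝ) ^ 12 / 4)) • symVh₂SAn1 3 n κ u κ' u') μ y ν y')
      = tadpole (coDressKBmAt (ctr 4 n) n (KInvStep (d := 3) n 0))
        (mixOfK (KInvStep (d := 3) n 0) n (M2Of 3 n (symTablesAn1S2 3 n cΛ).mixFF 0) μ y ν y' + mixOfK (KInvStep (d := 3) n 0) n (M2Of 3 n (symTablesAn1S2 3 n cΛ).mixFF 0) ν y' μ y) := by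
  -- abbreviations
  set K₀ : MKer (3 + 1) (Fib 3) := KInvStep (d := 3) n 0 with hK₀def
  set G₀ : MKer (3 + 1) (Fib 3) := coDressKBmAt (ctr 4 n) n K₀ with hG₀def
  set Sfl : Fin (3 + 1) → Site (3 + 1) → MKer (3 + 1) (Fib 3) :=
    fun κ u => ((n : ℝ) ^ 4) • wilsonA 3 κ u + (-((n : ℝ) ^ 8 / 2)) • symVhSAt (ctr 4 n) 3 n rfl κ u with hSfldef
  set M0 := (symTablesAn1S2 3 n cΛ).M 0 with hM0def
  set S₂ : Fin (3 + 1) → Site (3 + 1) → Fin (3 + 1) → Site (3 + 1) → MKer (3 + 1) (Fib 3) :=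
    fun κ u κ' u' => ((n : ℝ) ^ 8) • wilsonW₂ 3 ((8 * (N : ℝ) ^ 2)⁻¹ • wsym22 N) κ u κ' u' + (-((n : ℝ) ^ 12 / 4)) • symVh₂SAn1 3 n κ u κ' u' with hS₂def
  set M₂ := M2Of 3 n (symTablesAn1S2 3 n cΛ).mixFF 0 with hM₂def
  have hn1 : 1 ≤ n := Nat.one_le_iff_ne_zero.2 (NeZero.ne n)
  have hn0 : 0 < n := hn1
  have hK₀ : Spr K₀ := spr_KInvStep (d := 3) (Lc := n) 0
  have hG₀ : Spr G₀ := spr_G0bm_ctr (d := 3) (Lc := n)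
  have hG₀t : trK G₀ = sgnK G₀ := trK_coDressKBmAt_KInvStep (d := 3) (Lc := n) (ctrOff_mem_box hn1) 0
  have hKdec : ∃ δ C : ℝ, 0 < δ ∧ 0 ≤ C ∧ ExpKernelCalculus.Decays K₀ C δ := OneStepKernelFamily.decays_KInvStep (Lc := n) (d := 3) 0
  obtain ⟨Cfl, -, hSfl⟩ := locStencil_pure_zero (n := n) (symTablesAn1S2 3 n cΛ) (δ := 1) zero_le_one
  obtain ⟨CM, δM, hδM, hM0⟩ := (symTablesAn1S2 3 n cΛ).hM 0
  obtain ⟨C₂, δ₂, hδ₂, hS₂⟩ := locStencil₂_T2RecOf_symTablesAn1 (Lc := n) N cΛ 0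
  rw [T2RecOf_zero_level] at hS₂
  have hC₂ : 0 ≤ C₂ := hS₂.nonneg
  obtain ⟨CF, δF, hδF, hM₂⟩ := locStencilFM_literalM₂ n (symTablesAn1S2 3 n cΛ)
  -- localisation of the four straight words
  have hW2 : ∀ μ y ν y', Loc (vertex2OfK K₀ n S₂ μ y ν y') := fun μ y ν y' => loc_vertex2OfK_of_spr hK₀ hS₂ hC₂ hδ₂ μ y ν y'
  have hmix : ∀ μ y ν y', Loc (mixOfK K₀ n M₂ μ y ν y') := fun μ y ν y' => loc_mixOfK_of_spr hK₀ hM₂ hδF μ y ν y'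
  have hRG : ∀ μ y ν y', Loc (dM (K2OfK K₀ n Sfl M0 ν y') n Sfl M0 μ y) := fun μ y ν y' =>
    loc_dM_K2OfK hn0 hK₀ (S := Sfl) hSfl one_pos (M := M0) hM0 hδM ν y' μ y
  have hW2S : Loc (W2SymOfK K₀ n Sfl M0 S₂ M₂ μ y ν y') := by
    unfold W2SymOfK
    exact (((((hW2 μ y ν y').add (hmix μ y ν y')).add (hmix ν y' μ y)).add (hRG μ y ν y')).add
      ((((hW2 ν y' μ y).add (hmix ν y' μ y)).add (hmix μ y ν y')).add (hRG ν y' μ y))).smul _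
  -- the record's pair table is bounded and swap-symmetric ⇒ the swapped bi-vertex is the direct one
  have hB₂ : ∀ κ u κ' u' x z a b, |S₂ κ u κ' u' x z a b| ≤ C₂ := fun κ u κ' u' x z a b => by
    refine (hS₂ κ u κ' u' x z a b).trans ?_
    have e1 : Real.exp (-δ₂ * l1 (u' - u)) ≤ 1 :=
      Real.exp_le_one_iff.2 (mul_nonpos_of_nonpos_of_nonneg (neg_nonpos.2 hδ₂.le) (l1_nonneg _))
    have e2 : Real.exp (-δ₂ * (l1 (x - u) + l1 (z - u))) ≤ 1 :=
      Real.exp_le_one_iff.2 (mul_nonpos_of_nonpos_of_nonneg (neg_nonpos.2 hδ₂.le) (add_nonneg (l1_nonneg _) (l1_nonneg _)))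
    calc C₂ * Real.exp (-δ₂ * l1 (u' - u)) * Real.exp (-δ₂ * (l1 (x - u) + l1 (z - u)))
        ≤ C₂ * 1 * 1 := by gcongr
      _ = C₂ := by ring
  have hSw : (fun κ' u' κ u => S₂ κ u κ' u') = S₂ := by
    funext κ' u' κ u
    simp only [hS₂def]
    rw [wilsonW₂_smul, wilsonW₂_smul, wilsonW₂_wsym22_swap κ u κ' u', symVh₂SAn1_swap n κ u κ' u']
  have hv2 : vertex2OfK K₀ n S₂ ν y' μ y = vertex2OfK K₀ n S₂ μ y ν y' := by
    rw [vertex2OfK_swap_eq_transpose hKdec hB₂ μ y ν y', hSw]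
  -- the two response words are tadpole-null at `G₀` (row parity)
  have hSrow : ∀ κ u, trK (Sfl κ u) = -sgnK (Sfl κ u) := fun κ u =>
    parityOdd_add (parityOdd_smul _ (trK_wilsonA (d := 3) κ u)) (parityOdd_smul _ (trK_symVhSAt (ctr 4 n) n κ u))
  have hMrow : ∀ ρ w, trK (M0 ρ w) = -sgnK (M0 ρ w) := fun ρ w => trK_M1Of_symHessFFAt (ctr (3 + 1) n) cΛ 0 ρ w
  have hr1 : tadpole G₀ (dM (K2OfK K₀ n Sfl M0 ν y') n Sfl M0 μ y) = 0 :=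
    tadpole_dM_eq_zero_of_rows hG₀ hG₀t _ n hSrow hMrow μ y (hRG μ y ν y')
  have hr2 : tadpole G₀ (dM (K2OfK K₀ n Sfl M0 μ y) n Sfl M0 ν y') = 0 :=
    tadpole_dM_eq_zero_of_rows hG₀ hG₀t _ n hSrow hMrow ν y' (hRG ν y' μ y)
  -- bookkeeping
  rw [tadpole_sub hG₀ hW2S (hW2 μ y ν y')]
  unfold W2SymOfK W2OfK
  rw [hv2, tadpole_smul,
    tadpole_add hG₀ ((((hW2 μ y ν y').add (hmix μ y ν y')).add (hmix ν y' μ y)).add (hRG μ y ν y'))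
      ((((hW2 μ y ν y').add (hmix ν y' μ y)).add (hmix μ y ν y')).add (hRG ν y' μ y)),
    tadpole_add hG₀ (((hW2 μ y ν y').add (hmix μ y ν y')).add (hmix ν y' μ y)) (hRG μ y ν y'),
    tadpole_add hG₀ ((hW2 μ y ν y').add (hmix μ y ν y')) (hmix ν y' μ y), tadpole_add hG₀ (hW2 μ y ν y') (hmix μ y ν y'),
    tadpole_add hG₀ (((hW2 μ y ν y').add (hmix ν y' μ y)).add (hmix μ y ν y')) (hRG ν y' μ y),
    tadpole_add hG₀ ((hW2 μ y ν y').add (hmix ν y' μ y)) (hmix μ y ν y'), tadpole_add hG₀ (hW2 μ y ν y') (hmix ν y' μ y),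
    hr1, hr2, tadpole_add hG₀ (hmix μ y ν y') (hmix ν y' μ y)]
  ring

/-- **(ii) THE FACE MIXED WORD UNDER THE ROAD's TADPOLE** [our object] — TT21 `SymCorrectorMixedSiteNull.tadpole_WMs_eq` AT THE RECORD (`G := G₀`, `K := G₀`,
`M := H = symHessFFAt ρ_c n` (rows parity-odd: `trK_symHessFFAt`), `ξ′ := 2`, `ϱ := ρ_c`, `r := ctrOff 4 n`; `trK G₀ = sgnK G₀` by `BubbleParity.trK_coDressKBmAt_KInvStep`):
`tadpole G₀ (WMs[G₀] μ y ν y′) = ½·tadpole G₀ (conjV (V_H ν y′) (Θ′ μ y) + conjV (V_H μ y) (Θ′ ν y′))`, `V_H := vertexOfM G₀ n H`, `Θ′ μ y := diagK (z b ↦ Σ_α Σ_x colH G₀ n μ y α x·(2·faceWt r n α x))`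
— the anchor words drop, the left words are half commutators. -/
theorem tadpole_WMs_record_eq (μ : Fin 4) (y : Site 4) (ν : Fin 4) (y' : Site 4) :
    tadpole (coDressKBmAt (ctr 4 n) n (KInvStep (d := 3) n 0))
        (((mixOfK (coDressKBmAt (ctr 4 n) n (KInvStep (d := 3) n 0)) n (fun κ u ρ w => (if blk n ((n : ℤ) • w + (ctr 4 n)) = blk n u then 2 * faceWt (ctrOff 4 n) n κ u else 0) • (symHessFFAt (ctr 4 n) n) ρ w) μ y ν y'
                + mixOfK (coDressKBmAt (ctr 4 n) n (KInvStep (d := 3) n 0)) n (fun κ u ρ w => (if blk n ((n : ℤ) • w + (ctr 4 n)) = blk n u then 2 * faceWt (ctrOff 4 n) n κ u else 0) • (symHessFFAt (ctr 4 n) n) ρ w) ν y' μ y)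
              - (comp (diagK fun z b => ∑ α : Fin (3 + 1), ∑ x ∈ blockSitesF n (blk n (legSite (ctr 4 n) z b)), colH (coDressKBmAt (ctr 4 n) n (KInvStep (d := 3) n 0)) n μ y α x * (2 * faceWt (ctrOff 4 n) n α x)) (vertexOfM (coDressKBmAt (ctr 4 n) n (KInvStep (d := 3) n 0)) n (symHessFFAt (ctr 4 n) n) ν y')
                + comp (diagK fun z b => ∑ α : Fin (3 + 1), ∑ x ∈ blockSitesF n (blk n (legSite (ctr 4 n) z b)), colH (coDressKBmAt (ctr 4 n) n (KInvStep (d := 3) n 0)) n ν y' α x * (2 * faceWt (ctrOff 4 n) n α x)) (vertexOfM (coDressKBmAt (ctr 4 n) n (KInvStep (d := 3) n 0)) n (symHessFFAt (ctr 4 n) n) μ y))))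
      = (1 / 2 : ℝ) * tadpole (coDressKBmAt (ctr 4 n) n (KInvStep (d := 3) n 0))
        (conjV (vertexOfM (coDressKBmAt (ctr 4 n) n (KInvStep (d := 3) n 0)) n (symHessFFAt (ctr 4 n) n) ν y') (diagK fun z b => ∑ α : Fin (3 + 1), ∑ x ∈ blockSitesF n (blk n (legSite (ctr 4 n) z b)), colH (coDressKBmAt (ctr 4 n) n (KInvStep (d := 3) n 0)) n μ y α x * (2 * faceWt (ctrOff 4 n) n α x))
          + conjV (vertexOfM (coDressKBmAt (ctr 4 n) n (KInvStep (d := 3) n 0)) n (symHessFFAt (ctr 4 n) n) μ y) (diagK fun z b => ∑ α : Fin (3 + 1), ∑ x ∈ blockSitesF n (blk n (legSite (ctr 4 n) z b)), colH (coDressKBmAt (ctr 4 n) n (KInvStep (d := 3) n 0)) n ν y' α x * (2 * faceWt (ctrOff 4 n) n α x))) := by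
  have hn1 : 1 ≤ n := Nat.one_le_iff_ne_zero.2 (NeZero.ne n)
  have hn0 : 0 < n := hn1
  have hG₀ : Spr (coDressKBmAt (ctr 4 n) n (KInvStep (d := 3) n 0)) := spr_G0bm_ctr (d := 3) (Lc := n)
  have hG₀t : trK (coDressKBmAt (ctr 4 n) n (KInvStep (d := 3) n 0)) = sgnK (coDressKBmAt (ctr 4 n) n (KInvStep (d := 3) n 0)) :=
    trK_coDressKBmAt_KInvStep (d := 3) (Lc := n) (ctrOff_mem_box hn1) 0
  have hHv : VertexFamily (symHessFFAt (ctr 4 n) n) n (2 * (ell (3 + 1) n : ℝ) ^ 2 * Real.exp (4 * ((3 : ℝ) + 1) * n * 1)) 1 :=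
    vertexFamily_symHessFFAt (d := 3) hn1 (ctrOff_mem_box hn1) zero_le_one
  exact tadpole_WMs_eq hn0 hG₀ hG₀t hG₀ hHv one_pos (fun ρ w => trK_symHessFFAt (ctr 4 n) n ρ w) (ctr 4 n) (ctrOff 4 n) 2 μ y ν y'

/-- **(iii) THE COLUMN MIXED WORD UNDER THE ROAD's TADPOLE** [our object] — TT23 `DressedMixVertexSiteNull.tadpole_WMcol_eq_Wmix` AT THE RECORD (`K := K₀`,
`K′ = G₀ = coDressKBmAt (toSite (ctrOff 4 n)) n K₀`, `M₂ := M2Of 3 n tabs.mixFF 0` with the record's site letter `CombMixedSiteLetter.divV_M2Of_record_eq` (`Mt := H`, `ξ′ := 2`,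
`ϱ := ρ_c`), g53's column envelope `abs_colH_KInvStep_zero_le` at both bonds, `G := G₀`): `tadpole G₀ (W^{Mcol}_c μ y ν y′) = tadpole G₀ (([Λ′ ν y′, V_H μ y]) + ([Λ′ μ y, V_H ν y′]))`
with the UNIT-scalar column generator `Λ′ μ y := diagK (z b ↦ bmGaugeAt ρ_c (colH K₀ n μ y) n (legSite ρ_c z b))` and `V_H := vertexOfM K₀ n H` (`(2∕2)·` normalised to `1`) — the
bracket of leaf-01 g32's `ColumnGaugePairContact.vertexFamily₂_Wmix_of_weight` at `ξ := 1`. -/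
theorem tadpole_WMcol_record_eq (cΛ : ℝ) (μ : Fin 4) (y : Site 4) (ν : Fin 4) (y' : Site 4) :
    tadpole (coDressKBmAt (ctr 4 n) n (KInvStep (d := 3) n 0))
        (((mixOfK (coDressKBmAt (ctr 4 n) n (KInvStep (d := 3) n 0)) n (M2Of 3 n (symTablesAn1S2 3 n cΛ).mixFF 0) μ y ν y'
                - mixOfK (KInvStep (d := 3) n 0) n (M2Of 3 n (symTablesAn1S2 3 n cΛ).mixFF 0) μ y ν y')
            + (mixOfK (coDressKBmAt (ctr 4 n) n (KInvStep (d := 3) n 0)) n (M2Of 3 n (symTablesAn1S2 3 n cΛ).mixFF 0) ν y' μ y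
                - mixOfK (KInvStep (d := 3) n 0) n (M2Of 3 n (symTablesAn1S2 3 n cΛ).mixFF 0) ν y' μ y)))
      = tadpole (coDressKBmAt (ctr 4 n) n (KInvStep (d := 3) n 0))
        ((comp (diagK fun z b => bmGaugeAt (ctr 4 n) (colH (KInvStep (d := 3) n 0) n ν y') n (legSite (ctr 4 n) z b)) (vertexOfM (KInvStep (d := 3) n 0) n (symHessFFAt (ctr 4 n) n) μ y)
            - comp (vertexOfM (KInvStep (d := 3) n 0) n (symHessFFAt (ctr 4 n) n) μ y) (diagK fun z b => bmGaugeAt (ctr 4 n) (colH (KInvStep (d := 3) n 0) n ν y') n (legSite (ctr 4 n) z b)))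
          + (comp (diagK fun z b => bmGaugeAt (ctr 4 n) (colH (KInvStep (d := 3) n 0) n μ y) n (legSite (ctr 4 n) z b)) (vertexOfM (KInvStep (d := 3) n 0) n (symHessFFAt (ctr 4 n) n) ν y')
            - comp (vertexOfM (KInvStep (d := 3) n 0) n (symHessFFAt (ctr 4 n) n) ν y') (diagK fun z b => bmGaugeAt (ctr 4 n) (colH (KInvStep (d := 3) n 0) n μ y) n (legSite (ctr 4 n) z b)))) := by
  have hn1 : 1 ≤ n := Nat.one_le_iff_ne_zero.2 (NeZero.ne n)
  have hG₀ : Spr (coDressKBmAt (ctr 4 n) n (KInvStep (d := 3) n 0)) := spr_G0bm_ctr (d := 3) (Lc := n)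
  have hG₀t : trK (coDressKBmAt (ctr 4 n) n (KInvStep (d := 3) n 0)) = sgnK (coDressKBmAt (ctr 4 n) n (KInvStep (d := 3) n 0)) :=
    trK_coDressKBmAt_KInvStep (d := 3) (Lc := n) (ctrOff_mem_box hn1) 0
  have hKdec : ∃ δ C : ℝ, 0 < δ ∧ 0 ≤ C ∧ ExpKernelCalculus.Decays (KInvStep (d := 3) n 0) C δ := OneStepKernelFamily.decays_KInvStep (Lc := n) (d := 3) 0
  obtain ⟨CF, δF, hδF, hM₂⟩ := locStencilFM_literalM₂ n (symTablesAn1S2 3 n cΛ)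
  have hcol : ∀ (μ' : Fin (3 + 1)) (y : Site (3 + 1)) (κ : Fin (3 + 1)) (u : Site (3 + 1)), |colH (KInvStep (d := 3) n 0) n μ' y κ u|
      ≤ ((n : ℝ) ^ (3 + 2))⁻¹ * (MG163 (3 + 1) * periodConst (kappa163 (3 + 1)) 3)
          * Real.exp (-(kappa163 (3 + 1) / ((3 : ℝ) + 1) * supNorm (quo n u - y))) :=
    fun μ' y κ u => abs_colH_KInvStep_zero_le (d := 3) (N := n) hn1 μ' y κ u
  have hM : 0 ≤ ((n : ℝ) ^ (3 + 2))⁻¹ * (MG163 (3 + 1) * periodConst (kappa163 (3 + 1)) 3) :=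
    (mul_nonneg_iff_of_pos_right (Real.exp_pos _)).1 ((abs_nonneg _).trans (hcol 0 0 0 0))
  have hc : 0 < kappa163 (3 + 1) / ((3 : ℝ) + 1) := div_pos (kappa163_pos (3 + 1)) (by positivity)
  have hHv : VertexFamily (symHessFFAt (ctr 4 n) n) n (2 * (ell (3 + 1) n : ℝ) ^ 2 * Real.exp (4 * ((3 : ℝ) + 1) * n * 1)) 1 :=
    vertexFamily_symHessFFAt (d := 3) hn1 (ctrOff_mem_box hn1) zero_le_one
  have h := tadpole_WMcol_eq_Wmix hn1 (ctrOff_mem_box hn1) hKdec hM₂ hδF μ y ν y' hM hc (hcol μ y) (hcol ν y') hHv one_pos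
    (fun ρ w u' => divV_M2Of_record_eq cΛ ρ w u') hG₀ hG₀t (fun ρ w => trK_symHessFFAt (ctr 4 n) n ρ w)
  rw [show ((2 : ℝ) / 2) = 1 by norm_num, one_mul] at h
  exact h

end Summit.QuantumFields.BalabanUV.Beta.D1BFx.ChartDefectTwoPinsRest

end
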